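/-
Copyright (c) 2026 the pub-hodgecm2 formalisation cell (harness21).  New file.
Origin: seat `prover-pub-hodgecm-own-htheta-g10-0` (unit pub-hodgecm-own-htheta, gen 10; OWNER of the item-(vi) lineage, S2-CRUX owner,
Δ2-bridge contributor), 2026-08-23 — Δ2 BRIDGE §3 R2, cite legs in the μ-UNIFORM currency (`UniformOmega`, ✔ p366783
`AppendixC/Prop413DataOfTower.lean`): the two Prop-binders `h411` and `hsep` of the multiplicity pay-off
`UniformOmega.rank_intertwiningMap_rhoAt_rest_le_one_of_prop413AsPrinted` are REDUCED to the END's displayed AS-PRINTED families at the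
rests — [Liu2021, Def. 4.11] (`Def411AsPrinted`) and [Liu2021, Thm. 4.18 (2)] (a clause of `Thm418AsPrinted`, the displayed `hLiu`) — plus the
cross-`μ` separation leg ([Liu2021] App. D Lem. D.1 (3) shape).  Theorems only; count-neutral; HC_CM is NOT proved; «Δ2 BRIDGE CLOSED» is NOT claimed.
-/
import Literature.NumberTheory.Automorphic.Liu2021.AppendixC.Prop413DataOfTower
import Literature.NumberTheory.Automorphic.Liu2021.Def411AsPrinted
import HarnessLib

set_option autoImplicit false

/-!
# `h411` and `hsep` of the μ-uniform multiplicity pay-off from the AS-PRINTED families at the rests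

For `U : UniformOmega C`, a `ℂ[C.G]`-module `H` and ANY family of tails `tail μ hμ hw : RestTail C μ hμ` (so that `U.rest (tail μ hμ hw)` is
Thm. 4.18's rest at `μ`; at the model: `restTailOne …`, giving `restOfCharD … μ hμ hw` on the nose):

* `UniformOmega.adjectives_rhoAt_prop413Data_of_def411AsPrinted_rest` — `(∀ μ hμ hw, Def411AsPrinted (toThm418Data C (U.rest (tail μ hμ hw))))`
  ⟹ every summand of `U.prop413Data H` is irreducible-or-zero, smooth, admissible (the pay-off's `h411`; definitionally the same
  representations);
* `UniformOmega.admTriple_eq_of_areIsomorphic_of_thm418AsPrinted_rest` — `(∀ μ hμ hw, Thm418AsPrinted (toThm418Data C (U.rest (tail μ hμ hw))))`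
  (the END's displayed `hLiu` family) + `hμsep` (isomorphic non-zero summands have the same `μ`: the cross-`μ` leg, Lem. D.1 (3) +
  «`μ = ⊗ μ_v`», cf. `Prop413Data.admTriple_eq_of_areIsomorphic_of_local`) ⟹ the pay-off's `hsep`; the same-`μ` leg is EXACTLY the
  conjunct «mutually non-isomorphic» of Thm. 4.18 (2) (`Thm418Data.eq_of_areIsomorphic`).

## References
* [Liu2021] Y. Liu, *Fourier–Jacobi cycles and arithmetic relative trace formula*, Camb. J. Math. 9 (2021) 1–147 = arXiv:2102.11518 —
  Def. 4.11 (FJcycle.tex ll. 2083–2097), Def. 4.12, Prop. 4.13 (ll. 2113–2119), Thm. 4.18 (2) (l. 2241) and its proof (l. 2270),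
  App. D Lem. D.1 (3) (l. 5233).
* Tree: `AppendixC/Prop413DataOfTower.lean` (`UniformOmega`, `RestTail`, `UniformOmega.rest ∕ prop413Data`), `Liu2021/Def411AsPrinted.lean`,
  `Liu2021/Thm418AsPrinted.lean` (`Thm418Data.eq_of_areIsomorphic`), `Liu2021/Prop413MultLeOneOfAsPrinted.lean`.

HC_CM is NOT proved.
-/

noncomputable section

open NumberField

namespace Literature.NumberTheory.Automorphic.Liu2021.AppendixC

open Literature.RepresentationTheory

variable {F E : Type} [Field F] [NumberField F] [IsTotallyReal F] [Field E] [NumberField E] [Algebra F E]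
  [IsTotallyComplex E] [Algebra.IsQuadraticExtension F E]
variable {P5 : PropC5Data F E} {isotropicAt : ℕ → Prop} {C : Sec42Data P5 isotropicAt} (U : UniformOmega C)

namespace UniformOmega

/-- **Def. 4.11's adjectives, UNIFORMISED**: if [Liu2021, Def. 4.11] AS PRINTED holds at the rest `U.rest (tail μ hμ hw)` for every
conjugate-symplectic weight-one `μ` (any tails), then every summand `ω_t` of `U.prop413Data H` is irreducible-or-zero, smooth and admissible —
the `h411` binder of `rank_intertwiningMap_rhoAt_rest_le_one_of_prop413AsPrinted` (definitionally the same representations).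
[cite: Liu2021, Def. 4.11 (ll. 2083–2097)] -/
theorem adjectives_rhoAt_prop413Data_of_def411AsPrinted_rest (H : Type) [AddCommGroup H] [Module ℂ H]
    [Module (MonoidAlgebra ℂ C.G) H] [IsScalarTower ℂ (MonoidAlgebra ℂ C.G) H]
    (tail : ∀ (μ : IdeleClassGroup E →ₜ* Circle)
      (hμ : letI : IsCMField E := isCMField F E; IdeleClassGroup.IsConjugateSymplectic E μ),
      (letI : IsCMField E := isCMField F E; IdeleClassGroup.HasWeight E μ 1) → RestTail C μ hμ)
    (h411R : ∀ (μ : IdeleClassGroup E →ₜ* Circle)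
      (hμ : letI : IsCMField E := isCMField F E; IdeleClassGroup.IsConjugateSymplectic E μ)
      (hw : letI : IsCMField E := isCMField F E; IdeleClassGroup.HasWeight E μ 1),
      Def411AsPrinted (toThm418Data C (U.rest (tail μ hμ hw))))
    (t : (U.prop413Data H).AdmTriple) :
    IsIrreducibleOrZero ((U.prop413Data H).rhoAt t) ∧ IsSmoothRep ((U.prop413Data H).rhoAt t) ∧
      IsAdmissibleRep ((U.prop413Data H).rhoAt t) :=
  h411R t.1.μ t.1.isConjugateSymplectic t.2.1 t.1.ε t.1.χ


/-- **`hsep`, UNIFORMISED: its same-`μ` leg IS [Liu2021, Thm. 4.18 (2)] AS PRINTED at the rests.**  If Thm. 4.18 AS PRINTED holds at the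
rest `U.rest (tail μ hμ hw)` for every conjugate-symplectic weight-one `μ` (the displayed `hLiu` family, any tails) and isomorphic non-zero
summands have the same `μ` (`hμsep` — the cross-`μ` leg, [Liu2021] App. D Lem. D.1 (3) + «`μ = ⊗ μ_v`», cf.
`Prop413Data.admTriple_eq_of_areIsomorphic_of_local`), then the summands of `U.prop413Data H` are pairwise non-isomorphic — the `hsep`
binder of `rank_intertwiningMap_rhoAt_rest_le_one_of_prop413AsPrinted`.
[cite: Liu2021, Thm. 4.18 (2) (l. 2241); App. D Lemma D.1 (3) (l. 5233)] -/
theorem admTriple_eq_of_areIsomorphic_of_thm418AsPrinted_rest (H : Type) [AddCommGroup H] [Module ℂ H]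
    [Module (MonoidAlgebra ℂ C.G) H] [IsScalarTower ℂ (MonoidAlgebra ℂ C.G) H]
    (tail : ∀ (μ : IdeleClassGroup E →ₜ* Circle)
      (hμ : letI : IsCMField E := isCMField F E; IdeleClassGroup.IsConjugateSymplectic E μ),
      (letI : IsCMField E := isCMField F E; IdeleClassGroup.HasWeight E μ 1) → RestTail C μ hμ)
    (hLiuR : ∀ (μ : IdeleClassGroup E →ₜ* Circle)
      (hμ : letI : IsCMField E := isCMField F E; IdeleClassGroup.IsConjugateSymplectic E μ)
      (hw : letI : IsCMField E := isCMField F E; IdeleClassGroup.HasWeight E μ 1),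
      Thm418AsPrinted (toThm418Data C (U.rest (tail μ hμ hw))))
    (hμsep : ∀ s t : (U.prop413Data H).AdmTriple, Nontrivial ((U.prop413Data H).omegaAt s) →
      (∃ f : (U.prop413Data H).omegaAt s ≃ₗ[ℂ] (U.prop413Data H).omegaAt t,
        ∀ (g : C.G) (v : (U.prop413Data H).omegaAt s), f ((U.prop413Data H).rhoAt s g v) = (U.prop413Data H).rhoAt t g (f v)) →
      s.1.μ = t.1.μ)
    (s t : (U.prop413Data H).AdmTriple) (hs : Nontrivial ((U.prop413Data H).omegaAt s))
    (hst : ∃ f : (U.prop413Data H).omegaAt s ≃ₗ[ℂ] (U.prop413Data H).omegaAt t,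
      ∀ (g : C.G) (v : (U.prop413Data H).omegaAt s), f ((U.prop413Data H).rhoAt s g v) = (U.prop413Data H).rhoAt t g (f v)) :
    s = t := by
  have hμ : s.1.μ = t.1.μ := hμsep s t hs hst
  obtain ⟨⟨μ, hsμ, ε, χ⟩, hws, hadms⟩ := s
  obtain ⟨⟨μ', htμ, ε', χ'⟩, hwt, hadmt⟩ := t
  change μ = μ' at hμ
  subst hμ
  have hij : (⟨(ε, χ), hadms⟩ : (toThm418Data C (U.rest (tail μ hsμ hws))).AdmIndex) = ⟨(ε', χ'), hadmt⟩ :=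
    Thm418Data.eq_of_areIsomorphic (hLiuR μ hsμ hws) hst
  have hε : ε = ε' := congrArg (fun i : (toThm418Data C (U.rest (tail μ hsμ hws))).AdmIndex => i.1.1) hij
  have hχ : χ = χ' := congrArg (fun i : (toThm418Data C (U.rest (tail μ hsμ hws))).AdmIndex => i.1.2) hij
  subst hε hχ
  rfl

end UniformOmega

end Literature.NumberTheory.Automorphic.Liu2021.AppendixC

end
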